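import Summits.Ventures.YMGap.FlowData.RectTubeVacuumSector
import Literature.Analysis.OperatorTheory.PositiveKernelNormLogConvex
import HarnessLib

/-!
# Venture YMGap, track Y3 FLOW-DATA — `J ↦ log ‖T_J‖` is CONVEX on every rectangular tube (Kingman's log-convexity
# for the Wilson slice kernel; theorems only)

HONEST FRAMING: venture file of the cell `pub-ymgap` (QuantumFields programme), track Y3; FINITE rectangular torus,
compact group, continuous unitary `ρ`; a CROSS-β CONSISTENCY relation for the FLOW-TABLE's O0 quantity `ln ‖T_β‖`
(second differences along the table's β grid are non-negative), not a number, not a row, nothing about `L → ∞`, the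
continuum or a mass gap.

THE ARGUMENT.  The slice kernel `K_J(a,b) = e^{J mag(a)/2} (∫ e^{J elec(a,E,b)} dE) e^{J mag(b)/2}` is POINTWISE LOG-CONVEX
in the coupling `J`: the two outer factors are log-affine and the temporal integral is a moment generating function
(Hölder's inequality with exponents `1/θ, 1/(1−θ)`).  Kingman's theorem for positive kernel operators
(`Literature…PositiveKernelNormLogConvex.convexOn_log_norm_kernelOp`) then gives the convexity of `J ↦ log ‖T_J‖`.

* `integral_exp_mul_le_rpow_mul_rpow` — `∫ e^{(θJ₀+(1−θ)J₁) q} ≤ (∫ e^{J₀ q})^θ (∫ e^{J₁ q})^{1−θ}` for a continuous `q`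
  on a compact probability space (`0 ≤ θ ≤ 1`);
* `rectSliceKernel_convexComb_le` — `K_{θJ₀+(1−θ)J₁}(a,b) ≤ K_{J₀}(a,b)^θ K_{J₁}(a,b)^{1−θ}`;
* **`convexOn_log_norm_rectTubeTransferOperator`** — `ConvexOn ℝ univ (fun J => log ‖T_J‖)`;
* **`convexOn_log_norm_su2RectTubeTransferOperator`** — the cell's `β ↦ log ‖T_{β/2}‖` (`SU(2)`, `J = β/2`) is convex
  on `ℝ`; `log_norm_su2RectTubeTransferOperator_midpoint_le` — the midpoint form
  `2·log ‖T_{(β₀+β₁)/2}‖ ≤ log ‖T_{β₀}‖ + log ‖T_{β₁}‖`.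

References: J. F. C. Kingman, Quart. J. Math. 12 (1961) 283 [cite: Kingman1961, Theorem]; R. Drnovšek, A. Peperko /
K. Bogdanović, A. Peperko (2022) [cite: BogdanovicPeperko2022, Thm. 1.1 (i)]; K. Osterwalder, E. Seiler, Ann. Phys. 110
(1978) 440 §3 [cite: OsterwalderSeilerAnnPhys1978, §3].
-/

noncomputable section

open scoped BigOperators ENNReal
open MeasureTheory Filter Function
open Literature.MathematicalPhysics.QuantumFieldTheory Literature.Analysis.OperatorTheory
open Literature.MathematicalPhysics.QuantumLattice (RectTorusSite fundamentalRep continuous_fundamentalRep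
  fundamentalRep_mem_unitaryGroup)

namespace Summit.Ventures.YMGap.FlowData

/-! ### Hölder: a moment generating function is log-convex -/

section Holder

/-- **`∫ e^{(θJ₀+(1−θ)J₁) q} ≤ (∫ e^{J₀ q})^θ (∫ e^{J₁ q})^{1−θ}`** for a continuous `q` on a compact space with a finite
measure and `0 ≤ θ ≤ 1` (Hölder with exponents `1/θ`, `1/(1−θ)`). [folklore] -/
theorem integral_exp_mul_le_rpow_mul_rpow {Y : Type*} [TopologicalSpace Y] [CompactSpace Y] [MeasurableSpace Y]
    [OpensMeasurableSpace Y] {ν : Measure Y} [IsFiniteMeasure ν] {q : Y → ℝ} (hq : Continuous q) (J₀ J₁ : ℝ)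
    {θ : ℝ} (hθ0 : 0 ≤ θ) (hθ1 : θ ≤ 1) :
    ∫ y, Real.exp ((θ * J₀ + (1 - θ) * J₁) * q y) ∂ν ≤
      (∫ y, Real.exp (J₀ * q y) ∂ν) ^ θ * (∫ y, Real.exp (J₁ * q y) ∂ν) ^ (1 - θ) := by
  rcases hθ0.eq_or_lt with h0 | hθpos
  · subst h0
    simp
  rcases hθ1.eq_or_lt' with h1 | hθlt
  · subst h1
    simp
  -- `0 < θ < 1`: Hölder
  have h1θ : 0 < 1 - θ := by linarith
  set f : Y → ℝ := fun y => Real.exp (J₀ * q y) ^ θ with hf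
  set g : Y → ℝ := fun y => Real.exp (J₁ * q y) ^ (1 - θ) with hg
  have hfc : Continuous f := (Real.continuous_exp.comp (continuous_const.mul hq)).rpow_const fun _ => Or.inr hθ0
  have hgc : Continuous g := (Real.continuous_exp.comp (continuous_const.mul hq)).rpow_const fun _ => Or.inr h1θ.le
  have hfg : ∀ y, Real.exp ((θ * J₀ + (1 - θ) * J₁) * q y) = f y * g y := by
    intro y
    rw [hf, hg]
    dsimp only
    rw [← Real.exp_mul, ← Real.exp_mul, ← Real.exp_add]
    congr 1; ring
  simp_rw [hfg]
  have hpq : (1 / θ).HolderConjugate (1 / (1 - θ)) := Real.holderConjugate_one_div hθpos h1θ (by ring)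
  obtain ⟨Cf, hCf⟩ := isCompact_univ.exists_bound_of_continuousOn hfc.continuousOn
  obtain ⟨Cg, hCg⟩ := isCompact_univ.exists_bound_of_continuousOn hgc.continuousOn
  have hfm : MemLp f (ENNReal.ofReal (1 / θ)) ν :=
    MemLp.of_bound hfc.aestronglyMeasurable Cf (Eventually.of_forall fun y => hCf y (Set.mem_univ _))
  have hgm : MemLp g (ENNReal.ofReal (1 / (1 - θ))) ν :=
    MemLp.of_bound hgc.aestronglyMeasurable Cg (Eventually.of_forall fun y => hCg y (Set.mem_univ _))
  have h := integral_mul_le_Lp_mul_Lq_of_nonneg hpq (Eventually.of_forall fun y => by positivity)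
    (Eventually.of_forall fun y => by positivity) hfm hgm
  have hf' : ∀ y, f y ^ (1 / θ) = Real.exp (J₀ * q y) := fun y => by
    rw [hf]; dsimp only
    rw [← Real.rpow_mul (Real.exp_pos _).le, mul_one_div_cancel hθpos.ne', Real.rpow_one]
  have hg' : ∀ y, g y ^ (1 / (1 - θ)) = Real.exp (J₁ * q y) := fun y => by
    rw [hg]; dsimp only
    rw [← Real.rpow_mul (Real.exp_pos _).le, mul_one_div_cancel h1θ.ne', Real.rpow_one]
  simp_rw [hf', hg', one_div_one_div] at h
  exact h

end Holder

/-! ### The slice kernel is pointwise log-convex in the coupling; Kingman -/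

section Convexity

variable {G : Type*} [Group G] [TopologicalSpace G] [IsTopologicalGroup G] [CompactSpace G]
  [MeasurableSpace G] [BorelSpace G] [SecondCountableTopology G] {n : ℕ} (ρ : G →* Matrix (Fin n) (Fin n) ℂ)
  {k : ℕ} {Ls : Fin k → ℕ} [∀ i, NeZero (Ls i)]

/-- **Pointwise log-convexity of the slice kernel in `J`**: `K_{θJ₀+(1−θ)J₁}(a,b) ≤ K_{J₀}(a,b)^θ K_{J₁}(a,b)^{1−θ}`
(the outer factors are log-affine, the temporal integral by Hölder). [folklore] -/
theorem rectSliceKernel_convexComb_le (hρ : Continuous ρ) (J₀ J₁ : ℝ) {θ : ℝ} (hθ0 : 0 ≤ θ) (hθ1 : θ ≤ 1)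
    (a b : RectSlice Ls G) :
    rectSliceKernel (Ls := Ls) ρ (θ * J₀ + (1 - θ) * J₁) (θ * J₀ + (1 - θ) * J₁) a b ≤
      rectSliceKernel (Ls := Ls) ρ J₀ J₀ a b ^ θ * rectSliceKernel (Ls := Ls) ρ J₁ J₁ a b ^ (1 - θ) := by
  -- continuity of `E ↦ elec(a, E, b)`
  have hc1 : ∀ y : RectTorusSite Ls, Continuous fun E : RectTorusSite Ls → G => E y := fun y => continuous_apply y
  have hq : Continuous fun E : RectTorusSite Ls → G => rectElecSum (Ls := Ls) ρ a E b := by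
    unfold rectElecSum
    refine continuous_finsetSum _ fun x _ => continuous_finsetSum _ fun i _ => ?_
    exact (Complex.continuous_re.comp (Continuous.matrix_trace hρ)).comp
      ((((hc1 x).mul continuous_const).mul (hc1 _).inv).mul continuous_const)
  have hmid := integral_exp_mul_le_rpow_mul_rpow (ν := Measure.pi fun _ : RectTorusSite Ls => haarProbability G)
    hq J₀ J₁ hθ0 hθ1
  -- the exponential factors are log-affine
  have hexp : ∀ m : ℝ, Real.exp ((θ * J₀ + (1 - θ) * J₁) / 2 * m) =
      Real.exp (J₀ / 2 * m) ^ θ * Real.exp (J₁ / 2 * m) ^ (1 - θ) := by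
    intro m
    rw [← Real.exp_mul, ← Real.exp_mul, ← Real.exp_add]
    congr 1; ring
  unfold rectSliceKernel
  rw [hexp, hexp, Real.mul_rpow (mul_nonneg (Real.exp_pos _).le (integral_nonneg fun E => (Real.exp_pos _).le))
    (Real.exp_pos _).le, Real.mul_rpow (Real.exp_pos _).le (integral_nonneg fun E => (Real.exp_pos _).le),
    Real.mul_rpow (mul_nonneg (Real.exp_pos _).le (integral_nonneg fun E => (Real.exp_pos _).le))
    (Real.exp_pos _).le, Real.mul_rpow (Real.exp_pos _).le (integral_nonneg fun E => (Real.exp_pos _).le)]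
  have h1 : 0 ≤ Real.exp (J₀ / 2 * rectMagSum (Ls := Ls) ρ a) ^ θ * Real.exp (J₁ / 2 * rectMagSum (Ls := Ls) ρ a) ^ (1 - θ) := by
    positivity
  have h3 : 0 ≤ Real.exp (J₀ / 2 * rectMagSum (Ls := Ls) ρ b) ^ θ * Real.exp (J₁ / 2 * rectMagSum (Ls := Ls) ρ b) ^ (1 - θ) := by
    positivity
  calc Real.exp (J₀ / 2 * rectMagSum ρ a) ^ θ * Real.exp (J₁ / 2 * rectMagSum ρ a) ^ (1 - θ) *
        (∫ E, Real.exp ((θ * J₀ + (1 - θ) * J₁) * rectElecSum ρ a E b) ∂Measure.pi fun _ => haarProbability G) *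
        (Real.exp (J₀ / 2 * rectMagSum ρ b) ^ θ * Real.exp (J₁ / 2 * rectMagSum ρ b) ^ (1 - θ))
      ≤ Real.exp (J₀ / 2 * rectMagSum ρ a) ^ θ * Real.exp (J₁ / 2 * rectMagSum ρ a) ^ (1 - θ) *
        ((∫ E, Real.exp (J₀ * rectElecSum ρ a E b) ∂Measure.pi fun _ => haarProbability G) ^ θ *
          (∫ E, Real.exp (J₁ * rectElecSum ρ a E b) ∂Measure.pi fun _ => haarProbability G) ^ (1 - θ)) *
        (Real.exp (J₀ / 2 * rectMagSum ρ b) ^ θ * Real.exp (J₁ / 2 * rectMagSum ρ b) ^ (1 - θ)) :=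
        mul_le_mul_of_nonneg_right (mul_le_mul_of_nonneg_left hmid h1) h3
    _ = _ := by ring

/-- **Kingman for the Wilson tube: `J ↦ log ‖T_J‖` is convex on `ℝ`** (continuous unitary `ρ`; every `T_J ≠ 0`).
[cite: Kingman1961, Theorem] -/
theorem convexOn_log_norm_rectTubeTransferOperator (hρ : Continuous ρ) :
    ConvexOn ℝ Set.univ (fun J : ℝ => Real.log ‖rectTubeTransferOperator ρ J Ls‖) := by
  refine convexOn_log_norm_kernelOp (E := ℝ) (D := Set.univ) (μ := rectSliceMeasure G Ls)
    (K := fun J => rectSliceKernel (Ls := Ls) ρ J J) (A := fun J => rectTubeTransferOperator ρ J Ls)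
    (fun J _ => stronglyMeasurable_uncurry_rectSliceKernel ρ hρ J J) (fun J _ => exists_rectSliceKernel_le ρ hρ J J)
    (fun J _ a b => (rectSliceKernel_pos ρ hρ J J a b).le) (fun J _ => rectTubeTransferOperator_ae_eq J Ls hρ)
    (fun J₀ _ J₁ _ θ hθ0 hθ1 a b => ?_) convex_univ
    fun J _ => norm_pos_iff.1 (norm_rectTubeTransferOperator_pos J Ls hρ)
  simp only [smul_eq_mul]
  exact rectSliceKernel_convexComb_le ρ hρ J₀ J₁ hθ0 hθ1 a b

end Convexity

/-! ### The cell's `SU(2)` tube -/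

section SU2

variable {k : ℕ}

/-- **`β ↦ log ‖T_β‖` is convex on `ℝ`** for the `SU(2)` rectangular tube at Wilson coupling `β` (`J = β/2`): the
FLOW-TABLE's `ln ‖T‖` has non-negative second differences along any β grid. [cite: Kingman1961, Theorem] -/
theorem convexOn_log_norm_su2RectTubeTransferOperator (Ls : Fin k → ℕ) [∀ i, NeZero (Ls i)] :
    ConvexOn ℝ Set.univ (fun β : ℝ => Real.log ‖rectTubeTransferOperator (fundamentalRep (Fin 2)) (β / 2) Ls‖) := by
  haveI : SecondCountableTopology (Matrix.specialUnitaryGroup (Fin 2) ℂ) :=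
    Literature.MathematicalPhysics.QuantumLattice.secondCountableTopology_su2
  have h := convexOn_log_norm_rectTubeTransferOperator (fundamentalRep (Fin 2)) (Ls := Ls) (continuous_fundamentalRep (Fin 2))
  refine ⟨convex_univ, fun β₀ _ β₁ _ θ η hθ hη hθη => ?_⟩
  have h2 := h.2 (Set.mem_univ (β₀ / 2)) (Set.mem_univ (β₁ / 2)) hθ hη hθη
  simp only [smul_eq_mul] at h2 ⊢
  rw [show (θ * β₀ + η * β₁) / 2 = θ * (β₀ / 2) + η * (β₁ / 2) by ring]
  exact h2

/-- **Midpoint form**: `2·log ‖T_{(β₀+β₁)/2}‖ ≤ log ‖T_{β₀}‖ + log ‖T_{β₁}‖` for the `SU(2)` rectangular tube.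
[cite: Kingman1961, Theorem] -/
theorem log_norm_su2RectTubeTransferOperator_midpoint_le (Ls : Fin k → ℕ) [∀ i, NeZero (Ls i)] (β₀ β₁ : ℝ) :
    2 * Real.log ‖rectTubeTransferOperator (fundamentalRep (Fin 2)) (((β₀ + β₁) / 2) / 2) Ls‖ ≤
      Real.log ‖rectTubeTransferOperator (fundamentalRep (Fin 2)) (β₀ / 2) Ls‖ +
        Real.log ‖rectTubeTransferOperator (fundamentalRep (Fin 2)) (β₁ / 2) Ls‖ := by
  have h := (convexOn_log_norm_su2RectTubeTransferOperator Ls).2 (Set.mem_univ β₀) (Set.mem_univ β₁)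
    (show (0 : ℝ) ≤ 1 / 2 by norm_num) (show (0 : ℝ) ≤ 1 / 2 by norm_num) (by norm_num)
  simp only [smul_eq_mul] at h
  rw [show (1 / 2 : ℝ) * β₀ + 1 / 2 * β₁ = (β₀ + β₁) / 2 by ring] at h
  linarith

end SU2

end Summit.Ventures.YMGap.FlowData
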